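import Summits.BirchSwinnertonDyer.BirchSwinnertonDyer.Theorems.KimAtThreeShallowEqDeepTraceDualLattice
import Summits.BirchSwinnertonDyer.BirchSwinnertonDyer.Theorems.KimAtThreeFineKatoKPortJunctionAnomalous
import Summits.BirchSwinnertonDyer.BirchSwinnertonDyer.Theorems.KimAtThreeSemiLocalTraceDualTwistLocalLattice
import Summits.BirchSwinnertonDyer.BirchSwinnertonDyer.Theorems.KimAtThreeCyclotomicSigmaFrobenius
import Literature.NumberTheory.EllipticCurves.SerreOpenImageOrdinaryInertiaProofs
import HarnessLib

/-!
# Route `KimAtThreeKolyvagin` (W2): the per-factor TWISTED (Euler-factor) lattice bound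
# `p · exp*_{d_w}(H¹(L_w, T_pW)) ⊆ P_w^loc · 𝒪_w` at a TAME level on a good ANOMALOUS row — the lattice input of
# support item 20397 `FineKatoTauAnomalousThree` (cell `bsd-addord`, seat w2-c4 gen 12; `--supports` 19077, helper)

HONEST FRAMING.  TOOL theorems (local instances on `ℚ_v` exactly as in this seat's `KimAtThreeShallowEqDeepTraceDualLattice`
and w2-c3's `KimAtThreeDeepUpperTowerLattice`; no definition, no instance attribute on Mathlib types, no `sorry`);
nothing is closed or booked; BSD is not proved by any of this.  CONDITIONAL on ONE Literature cite fact, displayed: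
(S5b-tower) `PAdicHodge.exists_smul_range_expStarCoord_tower_iff_trace_log`.

WHY.  The good-ANOMALOUS `t = 0` rows of cruxes 19599 / 19077 rest on item 20397 (= (C1_τ), gen 9): the value datum
`Λ_{0,r}` must satisfy the TWISTED compatibility «`3·(φ(h) ⊗ 1 − Λ_{0,r}(y)) ∈ 3^{j+1}·Tw_{P_w} L_int`»
(`P_w = 3 − a₃[w] + [w²]`, `w·[3] = 1`), not the crude `3^b`-one; gen 10 derived (C1_τ) from the φ-level package
(C1ₑₓ^τ) (`KimAtThreeShallowEqDeepGoodOfDefinedKato`), and memo W2C4-ANOMALOUS-PORT-g9 §2 reduced (C1ₑₓ^τ) for Kato's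
DEFINED `Λ = exp*` to the LATTICE LEMMA `exp*_ω(H¹(K, T)) = E_p(φ⁻¹)·𝒪_K` (`K/ℚ_p` unramified, good reduction,
`E(K)[p] = 0`).  Since then the two halves of that lemma became kernel theorems: the E-side
`log_ω(E(L_w)) = E_p(φ)⁻¹𝒪_w` (w2-acc3 g7 `KimAtThreeEulerLatticeOfFrobenius` / `…AnomalousTorsion`, w2-kport g7–g8
junctions, final form `KPort.Kw.exists_padicLog_eq_iff_of_frobenius_of_natCard_eq_one`) and the duality
`(E_p(φ)⁻¹𝒪_𝔓)^∨ = E_p(φ⁻¹)𝒪_𝔓` (w2-acc3 g6 `KimAtThreeSemiLocalTraceDualTwistLocalLattice`).  THIS FILE joins them with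
(S5b-tower) exactly as `KimAtThreeShallowEqDeepTraceDualLattice` did for the untwisted bound:
* §1 `frobeniusTrace_ne_of_hasGoodReductionAtPrime` — Hasse: `a_p ≠ ±(p + 1)` (the binder of w2-acc3's duality);
* §2 `exists_point_padicLogPointFiniteExt_eq_of_eulerCondition` — on a good row with `p ∣ a_p − 1` and
  `#E(ℚ_p)[p] = 1`: every `o ∈ L_𝔓` with `p·o − a_p·σ_u o + σ_u² o ∈ p𝒪_𝔓` is `log_ω` of a point of `W ⊗ L_𝔓`
  (the kport / w2-acc3 lattice lemma — σ_u IS the Frobenius, w2-acc3 g8 `KimAtThreeCyclotomicSigmaFrobenius` — read with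
  the ALGEBRAIC Euler condition of w2-acc3's duality files);
* §3 **`exists_prime_mul_expStarOmegaHom_eq_eulerTwistLoc_of_facts`** — for every line datum `dw` at `L_{w₀}` with
  (RES_w): **`p · exp*_{dw}(z) = p·z′ − a_p·σ_w z′ + σ_w² z′` for some `z′ ∈ 𝒪_{w₀}`** (`w·[p] = 1`), i.e.
  `p · exp*_{dw}(H¹(L_{w₀}, T)) ⊆ P_w^loc·𝒪_{w₀} = p·E_p(σ_w)𝒪_{w₀}` — (S5b-tower) gives ONE `e` with
  `range(exp*_{e•dw}) = (log_ω E(L_{w₀}))^∨`, the unit step `e ∈ 𝒪_v`, §2 the points, §3 of w2-acc3 the dual.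
Consumer: this seat's `KimAtThreeShallowEqDeepTwistedOfKatoV2` ((C1ₑₓ^τ) ⟸ (S5a) ∧ (S5b-tower) ∧ hKatoV2ʷ on the
good anomalous rows; then 20397 BY NAME via gen 10's `fineKatoτ_of_definedKatoTwist`).

References: [Kato1993LNM1553] Ch. II §1.2.4, Thm. 1.4.1 (3)–(4); [BlochKato1990] §3 Prop. 3.8, Ex. 3.11;
[Kim2022StructureSelmer] Lemma 3.4, Cor. 3.5, Thm. 3.13; [SilvermanAEC2009] IV.6.4, V.1.1, VII.2–3;
[SerreLocalFields1979] Ch. I §8, Ch. III §5; [CasselsFrohlichANT1967] Ch. II §10, Ch. VII §1.1;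
memo HOME/w2c4/W2C4-ANOMALOUS-PORT-g9.md §2.
-/


set_option autoImplicit false
-- the Theorems namespace of a single-conjunct summit repeats the summit name by design (D-0017)
set_option linter.dupNamespace false

noncomputable section

open scoped NumberField NNReal Classical
open Field ValuativeRel IsDedekindDomain NumberField
open Literature.NumberTheory.GaloisRepresentations
open Literature.NumberTheory.GaloisRepresentations.PeriodRingData
open Literature.NumberTheory.PAdicHodge
open Literature.NumberTheory.EllipticCurves WeierstrassCurve
open Literature.NumberTheory.EllipticCurves.FormalGroupChart (padicLogPointFiniteExt padicLogPointFiniteExt_apply_eq_of_isEquiv)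
open Literature.NumberTheory.EllipticCurves.Kato2004.EulerSystemValues (cycLevel sigma)
open Literature.NumberTheory.AdelicBaseChange Literature.NumberTheory.Automorphic
open Summit.BirchSwinnertonDyer.BirchSwinnertonDyer.Theorems.KimAtThreeDeepLowerExpStarOmega
open Summit.BirchSwinnertonDyer.BirchSwinnertonDyer.Theorems.KimAtThreeDeepLowerExpStarOmegaPlace
open Summit.BirchSwinnertonDyer.BirchSwinnertonDyer.Theorems.KimAtThreeDeepUpperExpStarTowerRange
open Summit.BirchSwinnertonDyer.BirchSwinnertonDyer.Theorems.KimAtThreeDeepUpperExpStarUnit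
open Summit.BirchSwinnertonDyer.BirchSwinnertonDyer.Theorems.KimAtThreeDeepUpperFactorFieldNorm
open Summit.BirchSwinnertonDyer.BirchSwinnertonDyer.Theorems.KimAtThreeDeepUpperTowerLattice
open Summit.BirchSwinnertonDyer.BirchSwinnertonDyer.Theorems.KimAtThreeSemiLocalTraceDualLocal
open Summit.BirchSwinnertonDyer.BirchSwinnertonDyer.Theorems.KimAtThreeSemiLocalTraceDualTwistLocal
open Summit.BirchSwinnertonDyer.BirchSwinnertonDyer.Theorems.KimAtThreeSemiLocalTraceDualTwistLocalLattice
open Summit.BirchSwinnertonDyer.BirchSwinnertonDyer.Theorems.KimAtThreePortSharedSATCore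
  (exists_padicInt_coe_eq_of_norm_le_one)
open Summit.BirchSwinnertonDyer.BirchSwinnertonDyer.Theorems.KimAtThreeFineKatoPerFactorPlaces
  (three_mem_asIdeal_extension)
open Summit.BirchSwinnertonDyer.BirchSwinnertonDyer.Theorems.KPort
open Summit.BirchSwinnertonDyer.BirchSwinnertonDyer.Theorems.KimAtThreeKwFrobenius
open Summit.BirchSwinnertonDyer.BirchSwinnertonDyer.Theorems.KimAtThreeCyclotomicSigmaFrobenius
  (sigma_smul_sub_pow_mem exists_frobenius_sigma)
open Summit.BirchSwinnertonDyer.Rank1Residual.GaloisImage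
open Summit.BirchSwinnertonDyer.Rank1Residual.Additive.LocalLog (padicLog)
open Summit.BirchSwinnertonDyer.Rank1Residual.Additive Summit.BirchSwinnertonDyer.Rank1Residual.Additive.BallEval
open Literature.NumberTheory.EllipticCurves.Rank1Residual
open Literature.NumberTheory.EllipticCurves.FormalGroupChart
open Rat.HeightOneSpectrum

open Summit.BirchSwinnertonDyer.BirchSwinnertonDyer.Theorems.KimAtThreeShallowEqDeepSharpLattice

namespace Summit.BirchSwinnertonDyer.BirchSwinnertonDyer.Theorems.KimAtThreeShallowEqDeepTwistedLattice

variable (p : ℕ) [hp : Fact p.Prime]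

/-! ### §1 Hasse: `a_p ≠ ±(p+1)` at a good prime -/

section Frobenius

/-- Hasse at a good `p`: `a_p ≠ ±(p + 1)` (`a_p² ≤ 4p < (p + 1)²`). [cite: SilvermanAEC2009, Thm. V.1.1] -/
theorem frobeniusTrace_ne_of_hasGoodReductionAtPrime (W : WeierstrassCurve ℚ) [W.IsElliptic] [W.IsGloballyMinimal]
    (hgood : W.HasGoodReductionAtPrime p) {a : ℤ} (ha : W.frobeniusTrace p = a) :
    a ≠ (p : ℤ) + 1 ∧ a ≠ -((p : ℤ) + 1) := by
  have hH := W.frobeniusTrace_sq_le_four_mul p hgood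
  rw [ha] at hH
  have hp1 : (1 : ℤ) < p := by exact_mod_cast hp.out.one_lt
  constructor <;> intro h <;> subst h <;> nlinarith [hH, hp1]

end Frobenius

/-! ### §2 The E-side on a good ANOMALOUS row: the algebraic Euler condition gives a point -/

section Euler

variable {p}
variable (W : WeierstrassCurve ℚ) [W.IsElliptic] [W.IsGloballyMinimal] (m : ℕ) [NeZero m]

set_option backward.isDefEq.respectTransparency false in
/-- **Every `o ∈ L_𝔓` in the algebraic Euler lattice is a logarithm.**  `W/ℚ` globally minimal with GOOD reduction at
`p ≥ 3`, `a_p = a` with `p ∣ a − 1` (anomalous) and `#E(ℚ_p)[p] = 1` (items' spelling); `p ∤ m`, `u ≡ p (mod m)`,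
`𝔓 = w₀ ∣ p` a place of `ℚ(ζ_m)` (unramified), `σ_u` Kato's automorphism read on `L_𝔓`: if
`p·o − a·σ_u o + σ_u(σ_u o) = p·o′` with `o′ ∈ 𝒪_𝔓`, then `o = log_ω P′` for a point `P′` of `W ⊗ L_𝔓` (Mathlib's norm
valuation on `L_𝔓`).  = kport's `Kw.exists_padicLog_eq_iff_of_frobenius_of_natCard_eq_one` (w2-acc3 g7's lattice lemma, all
structural binders discharged) with `σ := σ_u` (§1: stabiliser + Frobenius congruence), `φ := (σ_u)_𝔓` on `K_𝔓`
(`exists_algHom_eq_galAdicCompletionMap`; σ_u's stabiliser / Frobenius congruence are w2-acc3's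
`sigma_smul_eq_self_of_coe_eq` / `sigma_smul_sub_pow_mem`), `e(𝔓∣p) = 1` (`KPort.ramificationIdx_eq_one_of_isCyclotomicExtension`),
`p ∤ Δ_min` (good reduction), and the norm bound `‖p·o′‖ ≤ ‖p‖`.
[cite: BlochKato1990, Example 3.11] [cite: SilvermanAEC2009, Thm. IV.6.4, Prop. VII.2.2, VII.3.1] [cite: SerreLocalFields1979, Ch. I §8, Ch. III §5] -/
theorem exists_point_padicLogPointFiniteExt_eq_of_eulerCondition (hp3 : 3 ≤ p)
    (hgood : W.HasGoodReductionAtPrime p) {a : ℤ} (ha : W.frobeniusTrace p = a) (hap : (p : ℤ) ∣ a - 1)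
    (ht : Nat.card {Q : (W.baseChange ℚ_[p]).toAffine.Point // (p : ℕ) • Q = 0} = 1)
    (hpm : ¬ p ∣ m) (u : (ZMod m)ˣ) (hu : (u : ZMod m) = (p : ZMod m))
    (w₀ : ((primesEquiv (R := 𝓞 ℚ)).symm ⟨p, hp.out⟩).Extension (𝓞 (CyclotomicField m ℚ)))
    (o : (w₀.1.adicCompletion (CyclotomicField m ℚ)))
    (ho : ∃ o' ∈ (w₀.1.adicCompletionIntegers (CyclotomicField m ℚ)),
      (p : (w₀.1.adicCompletion (CyclotomicField m ℚ))) * o - (a : (w₀.1.adicCompletion (CyclotomicField m ℚ))) * (galAdicCompletionMap (sigma m u) (sigma_smul_eq_self_of_coe_eq m p hpm u hu w₀) o) + (galAdicCompletionMap (sigma m u) (sigma_smul_eq_self_of_coe_eq m p hpm u hu w₀) (galAdicCompletionMap (sigma m u) (sigma_smul_eq_self_of_coe_eq m p hpm u hu w₀) o)) = (p : (w₀.1.adicCompletion (CyclotomicField m ℚ))) * o') :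
    haveI := Literature.NumberTheory.EllipticCurves.EulerLattice.isIntegral_baseChange w₀.1 W
    ∃ P' : (W.baseChange (w₀.1.adicCompletion (CyclotomicField m ℚ))).toAffine.Point,
      padicLogPointFiniteExt (NormedField.valuation : Valuation (w₀.1.adicCompletion (CyclotomicField m ℚ)) ℝ≥0) (W.baseChange (w₀.1.adicCompletion (CyclotomicField m ℚ))) p P' = o := by
  haveI : Fact (w₀.1.asIdeal.ramificationIdx (𝓞 ℚ) = 1) :=
    ⟨Kw.ramificationIdx_eq_one_of_isCyclotomicExtension (p := p) (w := w₀) m hpm⟩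
  have hΔ : ¬ (p : ℤ) ∣ minimalDiscriminantInt W := W.not_dvd_minimalDiscriminantInt_of_hasGoodReductionAtPrime' p hgood
  have hσ : sigma m u • w₀.1 = w₀.1 := sigma_smul_eq_self_of_coe_eq m p hpm u hu w₀
  have hσp : ∀ b : 𝓞 (CyclotomicField m ℚ), sigma m u • b - b ^ p ∈ w₀.1.asIdeal :=
    sigma_smul_sub_pow_mem m p hpm u hu w₀
  obtain ⟨φK, hφK⟩ := exists_algHom_eq_galAdicCompletionMap (p := p) (w := w₀) (sigma m u) hσ
  have hap' : (p : ℤ) ∣ W.frobeniusTrace p - 1 := by rw [ha]; exact hap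
  refine (Kw.exists_padicLog_eq_iff_of_frobenius_of_natCard_eq_one W hp3 hΔ hap' ht (sigma m u) hσ hσp φK hφK
    ((Kw.toCompletion p (CyclotomicField m ℚ) w₀).symm o)).mpr ?_
  obtain ⟨o', ho', hPo⟩ := ho
  -- the Euler operator of `φK` on `K_𝔓` IS `p·o − a·σ_u o + σ_u² o`, read back along the identity `K_𝔓 = L_𝔓`
  have hSU : ∀ x : Kw p (CyclotomicField m ℚ) w₀, Kw.toCompletion p (CyclotomicField m ℚ) w₀ (φK x) =
      (galAdicCompletionMap (sigma m u) (sigma_smul_eq_self_of_coe_eq m p hpm u hu w₀) (Kw.toCompletion p (CyclotomicField m ℚ) w₀ x)) := fun x => by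
    rw [hφK x]
  have key : φK (φK ((Kw.toCompletion p (CyclotomicField m ℚ) w₀).symm o)) -
      (W.frobeniusTrace p : Kw p (CyclotomicField m ℚ) w₀) * φK ((Kw.toCompletion p (CyclotomicField m ℚ) w₀).symm o) +
      (p : Kw p (CyclotomicField m ℚ) w₀) * (Kw.toCompletion p (CyclotomicField m ℚ) w₀).symm o =
      (Kw.toCompletion p (CyclotomicField m ℚ) w₀).symm ((p : (w₀.1.adicCompletion (CyclotomicField m ℚ))) * o') := by
    apply (Kw.toCompletion p (CyclotomicField m ℚ) w₀).injective
    rw [RingEquiv.apply_symm_apply, map_add, map_sub, map_mul, map_mul, map_intCast, map_natCast, hSU, hSU,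
      RingEquiv.apply_symm_apply, ha, ← hPo]
    ring
  rw [key, map_mul, map_natCast, norm_mul]
  have ho'1 : ‖(Kw.toCompletion p (CyclotomicField m ℚ) w₀).symm o'‖ ≤ 1 := by
    rw [Kw.norm_le_one_iff]
    exact (HeightOneSpectrum.mem_adicCompletionIntegers _ _ _).mp ho'
  exact mul_le_of_le_one_right (norm_nonneg _) ho'1

end Euler

/-! ### §3 The per-factor TWISTED trace-dual bound from (S5b-tower) -/

section Twisted

variable {p}

set_option backward.isDefEq.respectTransparency false in
set_option maxHeartbeats 800000 in
/-- **The per-factor TWISTED (Euler-factor) lattice bound** (`p ≥ 3`).  For `W/ℚ` globally minimal with GOOD reduction at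
`p`, `a_p = a ≡ 1 (mod p)` (anomalous), `#E(ℚ_p)[p] = 1`; a local Néron line `d` at `v_p` with Prop-1.2.3 binders and
`hdual`; a TAME level `m` (`p ∤ m`) with `u ≡ p`, `w·[p] = 1` in `(ℤ/m)ˣ`; a place `w₀ ∣ p` of `ℚ(ζ_m)` and a line datum
`dw` at `L_{w₀}` with (RES_w): **for every `z ∈ H¹(L_{w₀}, T_pW)` there is `z′ ∈ 𝒪_{w₀}` with
`p · exp*_{dw}(z) = p·z′ − a·σ_w z′ + σ_w(σ_w z′)`**, i.e. `p · exp*_{dw}(H¹) ⊆ P_w^loc·𝒪_{w₀} = p·E_p(σ_w)·𝒪_{w₀}`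
(`σ_w = σ_u⁻¹ = Frob⁻¹`).  Chain: (S5b-tower) gives ONE `e` with `range(exp*_{e•dw}) = (log_ω E(L_{w₀}))^∨` (trace
dual) and `hdual(e•d)`; the unit step gives `e ∈ 𝒪_v`; §2 puts every element of the algebraic Euler lattice
`{o : p·o − a·σ_u o + σ_u² o ∈ p𝒪_{w₀}}` among the logarithms, so `Tr_{L_{w₀}/ℚ_v}(o · exp*_{dw}(z)) ∈ 𝒪_v` on that
lattice; w2-acc3's `(E_p(φ)⁻¹𝒪_𝔓)^∨ = E_p(φ⁻¹)𝒪_𝔓` (`forall_trace_mul_mem_iff_exists_eq_eulerTwistLoc_smul`, `a ≠ ±(p+1)`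
by Hasse) concludes.  CONDITIONAL on (S5b-tower). [cite: Kato1993LNM1553, Ch. II §1.2.4, Thm. 1.4.1 (3)–(4)]
[cite: BlochKato1990, §3 Prop. 3.8, Ex. 3.11] [cite: Kim2022StructureSelmer, Lemma 3.4, Cor. 3.5 and the proof of Thm. 3.13]
[cite: SilvermanAEC2009, Thm. IV.6.4 (b), V.1.1, VII.3.1] -/
theorem exists_prime_mul_expStarOmegaHom_eq_eulerTwistLoc_of_facts (hp3 : 3 ≤ p)
    (hT₂ : exists_smul_range_expStarCoord_tower_iff_trace_log)
    (W : WeierstrassCurve ℚ) [W.IsElliptic] [W.IsGloballyMinimal] (hgood : W.HasGoodReductionAtPrime p)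
    {a : ℤ} (ha : W.frobeniusTrace p = a) (hap : (p : ℤ) ∣ a - 1)
    (ht : Nat.card {Q : (W.baseChange ℚ_[p]).toAffine.Point // (p : ℕ) • Q = 0} = 1)
    (m : ℕ) [NeZero m] (hpm : ¬ p ∣ m) (u w : (ZMod m)ˣ) (hu : (u : ZMod m) = (p : ZMod m))
    (hw : (w : ZMod m) * ((p : ℕ) : ZMod m) = 1)
    (w₀ : ((primesEquiv (R := 𝓞 ℚ)).symm ⟨p, hp.out⟩).Extension (𝓞 (CyclotomicField m ℚ))) :
    haveI : Fact (((p : ℕ) : 𝓞 ℚ) ∈ ((primesEquiv (R := 𝓞 ℚ)).symm ⟨p, hp.out⟩).asIdeal) := ⟨(natCast_mem_asIdeal_iff_eq_primesEquiv_symm _ hp.out).mpr rfl⟩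
    letI := valuativeRelPlace ((primesEquiv (R := 𝓞 ℚ)).symm ⟨p, hp.out⟩)
    letI := topologicalSpacePlace ((primesEquiv (R := 𝓞 ℚ)).symm ⟨p, hp.out⟩)
    haveI := isNonarchimedeanLocalField_place ((primesEquiv (R := 𝓞 ℚ)).symm ⟨p, hp.out⟩)
    haveI := charZero_place ((primesEquiv (R := 𝓞 ℚ)).symm ⟨p, hp.out⟩)
    letI := padicAlgebraPlace p ((primesEquiv (R := 𝓞 ℚ)).symm ⟨p, hp.out⟩)
    haveI := fact_not_isUnit_place p ((primesEquiv (R := 𝓞 ℚ)).symm ⟨p, hp.out⟩)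
    haveI := isAdicComplete_place p ((primesEquiv (R := 𝓞 ℚ)).symm ⟨p, hp.out⟩)
    letI := LocalField.charZero_adicCompletion w₀.1
    letI := LocalField.adicCompletionPadicAlgebra w₀.1 p (Kw.prime_mem_asIdeal w₀)
    haveI : Fact (¬ IsUnit ((p : ℕ) : integerC (w₀.1.adicCompletion (CyclotomicField m ℚ)))) := ⟨not_isUnit_natCast_integerC (LocalField.valuation_adicCompletion_natCast_lt_one w₀.1 p (Kw.prime_mem_asIdeal w₀))⟩
    haveI := isAdicComplete_integerC_natCast (LocalField.valuation_adicCompletion_natCast_lt_one w₀.1 p (Kw.prime_mem_asIdeal w₀))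
    ∀ (d : LocalNeronLineAt W p ((primesEquiv (R := 𝓞 ℚ)).symm ⟨p, hp.out⟩))
      (hinj : (bdRPeriodRingData (valuation_place_lt_one p ((primesEquiv (R := 𝓞 ℚ)).symm ⟨p, hp.out⟩))).CupLogInjective
        (logCyclotomic p) (localRationalTateRep W p (galRestrictPlace ((primesEquiv (R := 𝓞 ℚ)).symm ⟨p, hp.out⟩))))
      (hex : ∀ z : contOneCocycles (localRationalTateRep W p (galRestrictPlace ((primesEquiv (R := 𝓞 ℚ)).symm ⟨p, hp.out⟩))).toTopRep,
        (bdRPeriodRingData (valuation_place_lt_one p ((primesEquiv (R := 𝓞 ℚ)).symm ⟨p, hp.out⟩))).HasDualExp (logCyclotomic p)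
          (localRationalTateRep W p (galRestrictPlace ((primesEquiv (R := 𝓞 ℚ)).symm ⟨p, hp.out⟩))) fun σ => z.1 σ)
      (hdual : ∀ a' : ℚ_[p], (∃ y, expStarOmegaPadicAt d hinj hex
          (((Padic.adicCompletionEquiv (𝓞 ℚ) ⟨p, hp.out⟩).symm : (((primesEquiv (R := 𝓞 ℚ)).symm ⟨p, hp.out⟩).adicCompletion ℚ) →+* ℚ_[p])) y = a') ↔
        ∀ Q : (W.baseChange ℚ_[p]).toAffine.Point, ‖a' * padicLog (W.baseChange ℚ_[p]) Q‖ ≤ 1)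
      (dw : LocalNeronLine W (LocalField.valuation_adicCompletion_natCast_lt_one w₀.1 p (Kw.prime_mem_asIdeal w₀)) ((galRestrictPlace ((primesEquiv (R := 𝓞 ℚ)).symm ⟨p, hp.out⟩)).comp (absGaloisRestrict (((primesEquiv (R := 𝓞 ℚ)).symm ⟨p, hp.out⟩).adicCompletion ℚ) (w₀.1.adicCompletion (CyclotomicField m ℚ)))))
      (hinjw : (bdRPeriodRingData (LocalField.valuation_adicCompletion_natCast_lt_one w₀.1 p (Kw.prime_mem_asIdeal w₀))).CupLogInjective (logCyclotomic p) (localRationalTateRep W p ((galRestrictPlace ((primesEquiv (R := 𝓞 ℚ)).symm ⟨p, hp.out⟩)).comp (absGaloisRestrict (((primesEquiv (R := 𝓞 ℚ)).symm ⟨p, hp.out⟩).adicCompletion ℚ) (w₀.1.adicCompletion (CyclotomicField m ℚ))))))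
      (hexw : ∀ z : contOneCocycles (localRationalTateRep W p ((galRestrictPlace ((primesEquiv (R := 𝓞 ℚ)).symm ⟨p, hp.out⟩)).comp (absGaloisRestrict (((primesEquiv (R := 𝓞 ℚ)).symm ⟨p, hp.out⟩).adicCompletion ℚ) (w₀.1.adicCompletion (CyclotomicField m ℚ))))).toTopRep,
        (bdRPeriodRingData (LocalField.valuation_adicCompletion_natCast_lt_one w₀.1 p (Kw.prime_mem_asIdeal w₀))).HasDualExp (logCyclotomic p) (localRationalTateRep W p ((galRestrictPlace ((primesEquiv (R := 𝓞 ℚ)).symm ⟨p, hp.out⟩)).comp (absGaloisRestrict (((primesEquiv (R := 𝓞 ℚ)).symm ⟨p, hp.out⟩).adicCompletion ℚ) (w₀.1.adicCompletion (CyclotomicField m ℚ))))) fun σ => z.1 σ),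
      (∀ h : (tateLocalRep W p (Sum.inr ((primesEquiv (R := 𝓞 ℚ)).symm ⟨p, hp.out⟩))).cohomology 1,
        expStarOmegaHom (LocalField.valuation_adicCompletion_natCast_lt_one w₀.1 p (Kw.prime_mem_asIdeal w₀)) ((galRestrictPlace ((primesEquiv (R := 𝓞 ℚ)).symm ⟨p, hp.out⟩)).comp (absGaloisRestrict (((primesEquiv (R := 𝓞 ℚ)).symm ⟨p, hp.out⟩).adicCompletion ℚ) (w₀.1.adicCompletion (CyclotomicField m ℚ)))) dw hinjw hexw ((tateLocalRep W p (Sum.inr ((primesEquiv (R := 𝓞 ℚ)).symm ⟨p, hp.out⟩))).cohomologyRes (absGaloisRestrict (((primesEquiv (R := 𝓞 ℚ)).symm ⟨p, hp.out⟩).adicCompletion ℚ) (w₀.1.adicCompletion (CyclotomicField m ℚ))) 1 h) =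
        algebraMap (((primesEquiv (R := 𝓞 ℚ)).symm ⟨p, hp.out⟩).adicCompletion ℚ) (w₀.1.adicCompletion (CyclotomicField m ℚ)) (expStarOmegaAt d h)) →
      ∀ z, ∃ z' ∈ (w₀.1.adicCompletionIntegers (CyclotomicField m ℚ)),
        (p : (w₀.1.adicCompletion (CyclotomicField m ℚ))) * expStarOmegaHom (LocalField.valuation_adicCompletion_natCast_lt_one w₀.1 p (Kw.prime_mem_asIdeal w₀)) ((galRestrictPlace ((primesEquiv (R := 𝓞 ℚ)).symm ⟨p, hp.out⟩)).comp (absGaloisRestrict (((primesEquiv (R := 𝓞 ℚ)).symm ⟨p, hp.out⟩).adicCompletion ℚ) (w₀.1.adicCompletion (CyclotomicField m ℚ)))) dw hinjw hexw z = (p : (w₀.1.adicCompletion (CyclotomicField m ℚ))) * z' - (a : (w₀.1.adicCompletion (CyclotomicField m ℚ))) * (galAdicCompletionMap (sigma m w) (sigma_smul_eq_self_of_mul_coe_eq_one m p hpm w hw w₀) z') + (galAdicCompletionMap (sigma m w) (sigma_smul_eq_self_of_mul_coe_eq_one m p hpm w hw w₀) (galAdicCompletionMap (sigma m w) (sigma_smul_eq_self_of_mul_coe_eq_one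 m p hpm w hw w₀) z')) := by
  intro d hinj hex hdual dw hinjw hexw hres z
  haveI : Fact (((p : ℕ) : 𝓞 ℚ) ∈ ((primesEquiv (R := 𝓞 ℚ)).symm ⟨p, hp.out⟩).asIdeal) := ⟨(natCast_mem_asIdeal_iff_eq_primesEquiv_symm _ hp.out).mpr rfl⟩
  letI := valuativeRelPlace ((primesEquiv (R := 𝓞 ℚ)).symm ⟨p, hp.out⟩)
  letI := topologicalSpacePlace ((primesEquiv (R := 𝓞 ℚ)).symm ⟨p, hp.out⟩)
  haveI := isNonarchimedeanLocalField_place ((primesEquiv (R := 𝓞 ℚ)).symm ⟨p, hp.out⟩)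
  haveI := charZero_place ((primesEquiv (R := 𝓞 ℚ)).symm ⟨p, hp.out⟩)
  letI := padicAlgebraPlace p ((primesEquiv (R := 𝓞 ℚ)).symm ⟨p, hp.out⟩)
  haveI := fact_not_isUnit_place p ((primesEquiv (R := 𝓞 ℚ)).symm ⟨p, hp.out⟩)
  haveI := isAdicComplete_place p ((primesEquiv (R := 𝓞 ℚ)).symm ⟨p, hp.out⟩)
  letI := LocalField.charZero_adicCompletion w₀.1
  letI := LocalField.adicCompletionPadicAlgebra w₀.1 p (Kw.prime_mem_asIdeal w₀)
  haveI : Fact (¬ IsUnit ((p : ℕ) : integerC (w₀.1.adicCompletion (CyclotomicField m ℚ)))) := ⟨not_isUnit_natCast_integerC (LocalField.valuation_adicCompletion_natCast_lt_one w₀.1 p (Kw.prime_mem_asIdeal w₀))⟩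
  haveI := isAdicComplete_integerC_natCast (LocalField.valuation_adicCompletion_natCast_lt_one w₀.1 p (Kw.prime_mem_asIdeal w₀))
  -- `Place.Completion (inr v₀)` is `ℚ_{v₀}` by `rfl`: read the packet's algebra structure on it
  letI instEF : Algebra (NumberField.Place.Completion (K := ℚ) (Sum.inr ((primesEquiv (R := 𝓞 ℚ)).symm ⟨p, hp.out⟩))) (w₀.1.adicCompletion (CyclotomicField m ℚ)) :=
    inferInstanceAs (Algebra (((primesEquiv (R := 𝓞 ℚ)).symm ⟨p, hp.out⟩).adicCompletion ℚ) (w₀.1.adicCompletion (CyclotomicField m ℚ)))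
  -- a compatible `ℝ≥0`-valuation on `L_{w₀}` (the base-`p^{1/e}` norm of the synonym `Kwe`) and integrality
  haveI hνc := Kwe.compatible_normValuation (p := p) (L := (CyclotomicField m ℚ)) (w := w₀)
  haveI : (W.baseChange (w₀.1.adicCompletion (CyclotomicField m ℚ))).IsIntegral ((NormedField.valuation : Valuation (Kwe p (CyclotomicField m ℚ) w₀) ℝ≥0).comap (Kwe.toCompletion p (CyclotomicField m ℚ) w₀).symm.toRingHom).integer :=
    Kw.isIntegral_baseChange_of_isGloballyMinimal _ W
  -- (S5b-tower): ONE rescaling `e`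
  obtain ⟨e, he, hde, hrange⟩ := exists_smul_ranges_of_facts W p ((primesEquiv (R := 𝓞 ℚ)).symm ⟨p, hp.out⟩) (LocalField.valuation_adicCompletion_natCast_lt_one w₀.1 p (Kw.prime_mem_asIdeal w₀)) hT₂ d hinj hex ((NormedField.valuation : Valuation (Kwe p (CyclotomicField m ℚ) w₀) ℝ≥0).comap (Kwe.toCompletion p (CyclotomicField m ℚ) w₀).symm.toRingHom)
    dw hinjw hexw hres (((Padic.adicCompletionEquiv (𝓞 ℚ) ⟨p, hp.out⟩).symm : (((primesEquiv (R := 𝓞 ℚ)).symm ⟨p, hp.out⟩).adicCompletion ℚ) →+* ℚ_[p]))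
  -- the unit step: `e ∈ 𝒪_v`
  obtain ⟨heO, -⟩ := mem_integers_of_hdual_smul W p ((primesEquiv (R := 𝓞 ℚ)).symm ⟨p, hp.out⟩) d hinj hex _ hdual he hde
  have hE0 : algebraMap (((primesEquiv (R := 𝓞 ℚ)).symm ⟨p, hp.out⟩).adicCompletion ℚ) (w₀.1.adicCompletion (CyclotomicField m ℚ)) e ≠ 0 := (map_ne_zero _).mpr he
  have hEO : algebraMap (((primesEquiv (R := 𝓞 ℚ)).symm ⟨p, hp.out⟩).adicCompletion ℚ) (w₀.1.adicCompletion (CyclotomicField m ℚ)) e ∈ (w₀.1.adicCompletionIntegers (CyclotomicField m ℚ)) :=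
    w₀.adicCompletionSemialgHom_image_adicCompletionIntegers ℚ (CyclotomicField m ℚ) ⟨e, heO, rfl⟩
  -- `exp*_{dw} z = E · a'` with `a' := exp*_{E•dw} z` in the trace dual of `log_ω E(L_{w₀})`
  have haa' : expStarOmegaHom (LocalField.valuation_adicCompletion_natCast_lt_one w₀.1 p (Kw.prime_mem_asIdeal w₀)) ((galRestrictPlace ((primesEquiv (R := 𝓞 ℚ)).symm ⟨p, hp.out⟩)).comp (absGaloisRestrict (((primesEquiv (R := 𝓞 ℚ)).symm ⟨p, hp.out⟩).adicCompletion ℚ) (w₀.1.adicCompletion (CyclotomicField m ℚ)))) dw hinjw hexw z = algebraMap (((primesEquiv (R := 𝓞 ℚ)).symm ⟨p, hp.out⟩).adicCompletion ℚ) (w₀.1.adicCompletion (CyclotomicField m ℚ)) e *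
      expStarOmegaHom (LocalField.valuation_adicCompletion_natCast_lt_one w₀.1 p (Kw.prime_mem_asIdeal w₀)) ((galRestrictPlace ((primesEquiv (R := 𝓞 ℚ)).symm ⟨p, hp.out⟩)).comp (absGaloisRestrict (((primesEquiv (R := 𝓞 ℚ)).symm ⟨p, hp.out⟩).adicCompletion ℚ) (w₀.1.adicCompletion (CyclotomicField m ℚ)))) (dw.smul (algebraMap (((primesEquiv (R := 𝓞 ℚ)).symm ⟨p, hp.out⟩).adicCompletion ℚ) (w₀.1.adicCompletion (CyclotomicField m ℚ)) e) ((map_ne_zero (algebraMap (((primesEquiv (R := 𝓞 ℚ)).symm ⟨p, hp.out⟩).adicCompletion ℚ) (w₀.1.adicCompletion (CyclotomicField m ℚ)))).mpr he))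
        hinjw hexw z := by
    rw [expStarOmegaHom_apply, expStarOmegaHom_apply, expStarOmega_smul, ← mul_assoc, mul_inv_cancel₀ hE0, one_mul]
  have hdual' := (hrange (expStarOmegaHom (LocalField.valuation_adicCompletion_natCast_lt_one w₀.1 p (Kw.prime_mem_asIdeal w₀)) ((galRestrictPlace ((primesEquiv (R := 𝓞 ℚ)).symm ⟨p, hp.out⟩)).comp (absGaloisRestrict (((primesEquiv (R := 𝓞 ℚ)).symm ⟨p, hp.out⟩).adicCompletion ℚ) (w₀.1.adicCompletion (CyclotomicField m ℚ))))
      (dw.smul (algebraMap (((primesEquiv (R := 𝓞 ℚ)).symm ⟨p, hp.out⟩).adicCompletion ℚ) (w₀.1.adicCompletion (CyclotomicField m ℚ)) e) ((map_ne_zero (algebraMap (((primesEquiv (R := 𝓞 ℚ)).symm ⟨p, hp.out⟩).adicCompletion ℚ) (w₀.1.adicCompletion (CyclotomicField m ℚ)))).mpr he)) hinjw hexw z)).mp ⟨z, rfl⟩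
  -- the two `ℝ≥0`-valuations of `L_{w₀}` (Mathlib's norm, the synonym's norm) are equivalent: same `log_ω`
  have hequiv : (NormedField.valuation : Valuation (w₀.1.adicCompletion (CyclotomicField m ℚ)) ℝ≥0).IsEquiv ((NormedField.valuation : Valuation (Kwe p (CyclotomicField m ℚ) w₀) ℝ≥0).comap (Kwe.toCompletion p (CyclotomicField m ℚ) w₀).symm.toRingHom) := by
    rw [Valuation.isEquiv_iff_val_le_one]
    intro x
    rw [Valuation.comap_apply, NormedField.valuation_apply, NormedField.valuation_apply, ← NNReal.coe_le_coe,
      coe_nnnorm, NNReal.coe_one, ← NNReal.coe_le_coe, coe_nnnorm, NNReal.coe_one,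
      Valued.toNormedField.norm_le_one_iff]
    exact (Kwe.norm_le_one_iff (p := p) (L := (CyclotomicField m ℚ)) (w := w₀) _).symm
  haveI hIM := Literature.NumberTheory.EllipticCurves.EulerLattice.isIntegral_baseChange w₀.1 W
  -- Hasse: `a ≠ ±(p+1)`
  obtain ⟨ha1, ha2⟩ := frobeniusTrace_ne_of_hasGoodReductionAtPrime p W hgood ha
  haveI := HeightOneSpectrum.Extension.fintype (𝓞 ℚ) ℚ (CyclotomicField m ℚ) (𝓞 (CyclotomicField m ℚ)) ((primesEquiv (R := 𝓞 ℚ)).symm ⟨p, hp.out⟩)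
  -- THE KEY: the trace against the algebraic Euler lattice is integral
  have key : ∀ o : (w₀.1.adicCompletion (CyclotomicField m ℚ)),
      (∃ o' ∈ (w₀.1.adicCompletionIntegers (CyclotomicField m ℚ)),
        (p : (w₀.1.adicCompletion (CyclotomicField m ℚ))) * o - (a : (w₀.1.adicCompletion (CyclotomicField m ℚ))) * (galAdicCompletionMap (sigma m u) (sigma_smul_eq_self_of_coe_eq m p hpm u hu w₀) o) + (galAdicCompletionMap (sigma m u) (sigma_smul_eq_self_of_coe_eq m p hpm u hu w₀) (galAdicCompletionMap (sigma m u) (sigma_smul_eq_self_of_coe_eq m p hpm u hu w₀) o)) = (p : (w₀.1.adicCompletion (CyclotomicField m ℚ))) * o') →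
      Algebra.trace (((primesEquiv (R := 𝓞 ℚ)).symm ⟨p, hp.out⟩).adicCompletion ℚ) (w₀.1.adicCompletion (CyclotomicField m ℚ)) (o * expStarOmegaHom (LocalField.valuation_adicCompletion_natCast_lt_one w₀.1 p (Kw.prime_mem_asIdeal w₀)) ((galRestrictPlace ((primesEquiv (R := 𝓞 ℚ)).symm ⟨p, hp.out⟩)).comp (absGaloisRestrict (((primesEquiv (R := 𝓞 ℚ)).symm ⟨p, hp.out⟩).adicCompletion ℚ) (w₀.1.adicCompletion (CyclotomicField m ℚ)))) dw hinjw hexw z) ∈ ((primesEquiv (R := 𝓞 ℚ)).symm ⟨p, hp.out⟩).adicCompletionIntegers ℚ := by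
    rintro o ⟨o', ho', hPo⟩
    -- `E·o` is in the Euler lattice too (`E ∈ ℚ_v` is fixed by `σ_u`, `E·o' ∈ 𝒪`)
    have hSE : (galAdicCompletionMap (sigma m u) (sigma_smul_eq_self_of_coe_eq m p hpm u hu w₀) (algebraMap (((primesEquiv (R := 𝓞 ℚ)).symm ⟨p, hp.out⟩).adicCompletion ℚ) (w₀.1.adicCompletion (CyclotomicField m ℚ)) e)) =
        algebraMap (((primesEquiv (R := 𝓞 ℚ)).symm ⟨p, hp.out⟩).adicCompletion ℚ) (w₀.1.adicCompletion (CyclotomicField m ℚ)) e :=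
      galAdicCompletionMap_algebraMap_adicCompletion _ (sigma m u) w₀ w₀ _ e
    have hEo : ∃ o'' ∈ (w₀.1.adicCompletionIntegers (CyclotomicField m ℚ)),
        (p : (w₀.1.adicCompletion (CyclotomicField m ℚ))) * (algebraMap (((primesEquiv (R := 𝓞 ℚ)).symm ⟨p, hp.out⟩).adicCompletion ℚ) (w₀.1.adicCompletion (CyclotomicField m ℚ)) e * o) -
          (a : (w₀.1.adicCompletion (CyclotomicField m ℚ))) * (galAdicCompletionMap (sigma m u) (sigma_smul_eq_self_of_coe_eq m p hpm u hu w₀) (algebraMap (((primesEquiv (R := 𝓞 ℚ)).symm ⟨p, hp.out⟩).adicCompletion ℚ) (w₀.1.adicCompletion (CyclotomicField m ℚ)) e * o)) +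
          (galAdicCompletionMap (sigma m u) (sigma_smul_eq_self_of_coe_eq m p hpm u hu w₀) (galAdicCompletionMap (sigma m u) (sigma_smul_eq_self_of_coe_eq m p hpm u hu w₀) (algebraMap (((primesEquiv (R := 𝓞 ℚ)).symm ⟨p, hp.out⟩).adicCompletion ℚ) (w₀.1.adicCompletion (CyclotomicField m ℚ)) e * o))) =
        (p : (w₀.1.adicCompletion (CyclotomicField m ℚ))) * o'' := by
      refine ⟨algebraMap (((primesEquiv (R := 𝓞 ℚ)).symm ⟨p, hp.out⟩).adicCompletion ℚ) (w₀.1.adicCompletion (CyclotomicField m ℚ)) e * o', mul_mem hEO ho', ?_⟩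
      have h3 : (galAdicCompletionMap (sigma m u) (sigma_smul_eq_self_of_coe_eq m p hpm u hu w₀) (algebraMap (((primesEquiv (R := 𝓞 ℚ)).symm ⟨p, hp.out⟩).adicCompletion ℚ) (w₀.1.adicCompletion (CyclotomicField m ℚ)) e * o)) =
          algebraMap (((primesEquiv (R := 𝓞 ℚ)).symm ⟨p, hp.out⟩).adicCompletion ℚ) (w₀.1.adicCompletion (CyclotomicField m ℚ)) e * (galAdicCompletionMap (sigma m u) (sigma_smul_eq_self_of_coe_eq m p hpm u hu w₀) o) := by rw [map_mul, hSE]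
      have h4 : (galAdicCompletionMap (sigma m u) (sigma_smul_eq_self_of_coe_eq m p hpm u hu w₀) (galAdicCompletionMap (sigma m u) (sigma_smul_eq_self_of_coe_eq m p hpm u hu w₀) (algebraMap (((primesEquiv (R := 𝓞 ℚ)).symm ⟨p, hp.out⟩).adicCompletion ℚ) (w₀.1.adicCompletion (CyclotomicField m ℚ)) e * o))) =
          algebraMap (((primesEquiv (R := 𝓞 ℚ)).symm ⟨p, hp.out⟩).adicCompletion ℚ) (w₀.1.adicCompletion (CyclotomicField m ℚ)) e * (galAdicCompletionMap (sigma m u) (sigma_smul_eq_self_of_coe_eq m p hpm u hu w₀) (galAdicCompletionMap (sigma m u) (sigma_smul_eq_self_of_coe_eq m p hpm u hu w₀) o)) := by rw [h3, map_mul, hSE]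
      rw [h4, h3]
      calc (p : (w₀.1.adicCompletion (CyclotomicField m ℚ))) * (algebraMap (((primesEquiv (R := 𝓞 ℚ)).symm ⟨p, hp.out⟩).adicCompletion ℚ) (w₀.1.adicCompletion (CyclotomicField m ℚ)) e * o) -
            (a : (w₀.1.adicCompletion (CyclotomicField m ℚ))) * (algebraMap (((primesEquiv (R := 𝓞 ℚ)).symm ⟨p, hp.out⟩).adicCompletion ℚ) (w₀.1.adicCompletion (CyclotomicField m ℚ)) e * (galAdicCompletionMap (sigma m u) (sigma_smul_eq_self_of_coe_eq m p hpm u hu w₀) o)) +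
            algebraMap (((primesEquiv (R := 𝓞 ℚ)).symm ⟨p, hp.out⟩).adicCompletion ℚ) (w₀.1.adicCompletion (CyclotomicField m ℚ)) e * (galAdicCompletionMap (sigma m u) (sigma_smul_eq_self_of_coe_eq m p hpm u hu w₀) (galAdicCompletionMap (sigma m u) (sigma_smul_eq_self_of_coe_eq m p hpm u hu w₀) o))
          = algebraMap (((primesEquiv (R := 𝓞 ℚ)).symm ⟨p, hp.out⟩).adicCompletion ℚ) (w₀.1.adicCompletion (CyclotomicField m ℚ)) e *
              ((p : (w₀.1.adicCompletion (CyclotomicField m ℚ))) * o - (a : (w₀.1.adicCompletion (CyclotomicField m ℚ))) * (galAdicCompletionMap (sigma m u) (sigma_smul_eq_self_of_coe_eq m p hpm u hu w₀) o) + (galAdicCompletionMap (sigma m u) (sigma_smul_eq_self_of_coe_eq m p hpm u hu w₀) (galAdicCompletionMap (sigma m u) (sigma_smul_eq_self_of_coe_eq m p hpm u hu w₀) o))) := by ring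
        _ = algebraMap (((primesEquiv (R := 𝓞 ℚ)).symm ⟨p, hp.out⟩).adicCompletion ℚ) (w₀.1.adicCompletion (CyclotomicField m ℚ)) e * ((p : (w₀.1.adicCompletion (CyclotomicField m ℚ))) * o') := by rw [hPo]
        _ = (p : (w₀.1.adicCompletion (CyclotomicField m ℚ))) * (algebraMap (((primesEquiv (R := 𝓞 ℚ)).symm ⟨p, hp.out⟩).adicCompletion ℚ) (w₀.1.adicCompletion (CyclotomicField m ℚ)) e * o') := by ring
    obtain ⟨P₀, hP₀⟩ := exists_point_padicLogPointFiniteExt_eq_of_eulerCondition W m hp3 hgood ha hap ht hpm u hu w₀ _ hEo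
    -- move the point to the consumer's `ℚ`-algebra structure on `L_{w₀}` (ring maps `ℚ → L_{w₀}` are unique)
    haveI hI2 : (W.baseChange (w₀.1.adicCompletion (CyclotomicField m ℚ))).IsIntegral (NormedField.valuation : Valuation (w₀.1.adicCompletion (CyclotomicField m ℚ)) ℝ≥0).integer :=
      Kw.isIntegral_baseChange_of_isGloballyMinimal _ W
    obtain ⟨P', hP'⟩ := Kw.exists_point_padicLogPointFiniteExt_eq_of_eq (NormedField.valuation : Valuation (w₀.1.adicCompletion (CyclotomicField m ℚ)) ℝ≥0)
      (V' := W.baseChange (w₀.1.adicCompletion (CyclotomicField m ℚ)))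
      (by rw [WeierstrassCurve.baseChange, WeierstrassCurve.baseChange]; congr 1; exact Subsingleton.elim _ _) p P₀
    -- read the logarithm in the synonym's currency and apply the trace-dual description of `range(exp*_{E•dw})`
    have hP'' : padicLogPointFiniteExt ((NormedField.valuation : Valuation (Kwe p (CyclotomicField m ℚ) w₀) ℝ≥0).comap (Kwe.toCompletion p (CyclotomicField m ℚ) w₀).symm.toRingHom) (W.baseChange (w₀.1.adicCompletion (CyclotomicField m ℚ))) p P' =
        algebraMap (((primesEquiv (R := 𝓞 ℚ)).symm ⟨p, hp.out⟩).adicCompletion ℚ) (w₀.1.adicCompletion (CyclotomicField m ℚ)) e * o := by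
      rw [← padicLogPointFiniteExt_apply_eq_of_isEquiv hequiv p P', hP', hP₀]
    have h1 := hdual' P'
    rw [hP'', Kw.trace_adicCompletionPadicAlgebra_eq w₀ (Kw.prime_mem_asIdeal w₀)] at h1
    have h2 := mem_adicCompletionIntegers_of_norm_symm_le_one p _ h1
    rw [haa', show o * (algebraMap (((primesEquiv (R := 𝓞 ℚ)).symm ⟨p, hp.out⟩).adicCompletion ℚ) (w₀.1.adicCompletion (CyclotomicField m ℚ)) e *
        expStarOmegaHom (LocalField.valuation_adicCompletion_natCast_lt_one w₀.1 p (Kw.prime_mem_asIdeal w₀)) ((galRestrictPlace ((primesEquiv (R := 𝓞 ℚ)).symm ⟨p, hp.out⟩)).comp (absGaloisRestrict (((primesEquiv (R := 𝓞 ℚ)).symm ⟨p, hp.out⟩).adicCompletion ℚ) (w₀.1.adicCompletion (CyclotomicField m ℚ)))) (dw.smul (algebraMap (((primesEquiv (R := 𝓞 ℚ)).symm ⟨p, hp.out⟩).adicCompletion ℚ) (w₀.1.adicCompletion (CyclotomicField m ℚ)) e) ((map_ne_zero (algebraMap (((primesEquiv (R := 𝓞 ℚ)).symm ⟨p, hp.out⟩).adicCompletion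 ℚ) (w₀.1.adicCompletion (CyclotomicField m ℚ)))).mpr he)) hinjw hexw z) =
      expStarOmegaHom (LocalField.valuation_adicCompletion_natCast_lt_one w₀.1 p (Kw.prime_mem_asIdeal w₀)) ((galRestrictPlace ((primesEquiv (R := 𝓞 ℚ)).symm ⟨p, hp.out⟩)).comp (absGaloisRestrict (((primesEquiv (R := 𝓞 ℚ)).symm ⟨p, hp.out⟩).adicCompletion ℚ) (w₀.1.adicCompletion (CyclotomicField m ℚ)))) (dw.smul (algebraMap (((primesEquiv (R := 𝓞 ℚ)).symm ⟨p, hp.out⟩).adicCompletion ℚ) (w₀.1.adicCompletion (CyclotomicField m ℚ)) e) ((map_ne_zero (algebraMap (((primesEquiv (R := 𝓞 ℚ)).symm ⟨p, hp.out⟩).adicCompletion ℚ) (w₀.1.adicCompletion (CyclotomicField m ℚ)))).mpr he)) hinjw hexw z *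
        (algebraMap (((primesEquiv (R := 𝓞 ℚ)).symm ⟨p, hp.out⟩).adicCompletion ℚ) (w₀.1.adicCompletion (CyclotomicField m ℚ)) e * o) by ring]
    exact h2
  -- w2-acc3's duality `(E_p(φ)⁻¹𝒪_𝔓)^∨ = E_p(φ⁻¹)𝒪_𝔓`
  exact (forall_trace_mul_mem_iff_exists_eq_eulerTwistLoc_smul m p hpm u w hu hw ha1 ha2 w₀ (expStarOmegaHom (LocalField.valuation_adicCompletion_natCast_lt_one w₀.1 p (Kw.prime_mem_asIdeal w₀)) ((galRestrictPlace ((primesEquiv (R := 𝓞 ℚ)).symm ⟨p, hp.out⟩)).comp (absGaloisRestrict (((primesEquiv (R := 𝓞 ℚ)).symm ⟨p, hp.out⟩).adicCompletion ℚ) (w₀.1.adicCompletion (CyclotomicField m ℚ)))) dw hinjw hexw z)).mp key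

end Twisted

end Summit.BirchSwinnertonDyer.BirchSwinnertonDyer.Theorems.KimAtThreeShallowEqDeepTwistedLattice

end
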